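import Literature.NumberTheory.LFunctions.RodgersTaoAsymptoticsProofs
import HarnessLib

/-!
# Rodgers–Tao 2020, Lemma 2.1 (8) for `t ≤ 0` as a reduction — proofs

Topic: NumberTheory/LFunctions (trunk T-ANT). Companion ("Proofs") file of
`Literature.NumberTheory.LFunctions.RodgersTaoAsymptotics` (B. Rodgers, T. Tao, *The de
Bruijn–Newman constant is non-negative*, Forum Math. Pi 8 (2020) e6, §2, Lemma 2.1 = FMP Lemma 4,
p. 8), cell rh-crit C3, rt-lead open list Q8(a).

RH-FREE CONTENT. `rodgersTao_H_asymp_of`: the two-sided main asymptotic (8)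
`H_t(x − iκ log₊ x) = exp(−πx/8 + O_C(log₊² x))` (`−T₀ ≤ t ≤ 0`, `x ≥ C''`, `C' ≤ κ ≤ C`), typed as
`Literature.NumberTheory.LFunctions.rodgersTao_H_asymp`, FOLLOWS from the two remaining `t < 0`
saddle-point facts of the source's proof — the last display of the proof of Lemma 2.1 (FMP p. 19)
`H_t(x − iy) = (½ + O_C(log₊² x/x)) Q_{t,1}` (`rodgersTao_H_eq_half_Q_one`) and eq. (36) (p. 18)
`|Q_{t,1}| = (2π² + O_C(x^{-1/2})) (x/4π)^{(9+y)/4} J_t` (`rodgersTao_Q_one_asymp`) — together with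
the PROVED `t = 0` endpoint `rodgersTao_H0_twoSided_holds` (display after (13), p. 9). This is the
printed architecture of the proof of (8) (FMP pp. 11–19: «Inserting these bounds into (18) …»);
the bookkeeping here is `log((x/4π)^{(9+κ log₊ x)/4} J_t(x)) = −πx/8 + O_{C,T₀}(log₊² x)` from the
definition (35) of `J_t`. No new facts: once (36) and the p. 19 display are discharged, (8) is.

WHAT THIS IS NOT: an implication between typed asymptotic statements about `H_t`, `t ≤ 0`;
bears_on N-C/N-P (COLUMN 3 DBN); nothing here bears on the truth of RH.

## References

* [RodgersTaoFMP2020] B. Rodgers, T. Tao, *The de Bruijn–Newman constant is non-negative*, Forum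
  Math. Pi 8 (2020), e6, doi:10.1017/fmp.2020.6 — Lemma 2.1 = Lemma 4 eq. (8) p. 8; §2 eq. (35),
  (36) p. 18; last display of the proof of Lemma 2.1, p. 19; display after (13), p. 9.
-/

noncomputable section

open Complex Real Set

namespace Literature.NumberTheory.LFunctions

/-- `log y ≤ 4 √(√y)` for `y > 0` (i.e. `log y ≤ 4 y^{1/4}`). [folklore] -/
private theorem rtma_log_le_four_mul_sqrt_sqrt {y : ℝ} (hy : 0 < y) :
    Real.log y ≤ 4 * Real.sqrt (Real.sqrt y) := by
  have h1 : Real.log y = 4 * Real.log (Real.sqrt (Real.sqrt y)) := by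
    rw [Real.log_sqrt (Real.sqrt_nonneg _), Real.log_sqrt hy.le]; ring
  have h2 : Real.log (Real.sqrt (Real.sqrt y)) ≤ Real.sqrt (Real.sqrt y) - 1 :=
    Real.log_le_sub_one_of_pos (Real.sqrt_pos.mpr (Real.sqrt_pos.mpr hy))
  linarith

/-- `log₊² x ≤ 23 √x` for `x ≥ 2`. [folklore] -/
private theorem rtma_logPlus_sq_le_sqrt {x : ℝ} (hx : 2 ≤ x) : logPlus x ^ 2 ≤ 23 * Real.sqrt x := by
  have hx0 : 0 < x := by linarith
  have hs : logPlus x ≤ 4 * Real.sqrt (Real.sqrt (2 + x)) := by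
    rw [logPlus_eq, abs_of_pos hx0]; exact rtma_log_le_four_mul_sqrt_sqrt (by linarith)
  have hL0 : 0 ≤ logPlus x := logPlus_nonneg x
  have h1 : logPlus x ^ 2 ≤ 16 * Real.sqrt (2 + x) := by
    calc logPlus x ^ 2 ≤ (4 * Real.sqrt (Real.sqrt (2 + x))) ^ 2 := pow_le_pow_left₀ hL0 hs 2
      _ = 16 * Real.sqrt (2 + x) := by rw [mul_pow, Real.sq_sqrt (Real.sqrt_nonneg _)]; norm_num
  have h2 : Real.sqrt (2 + x) ≤ Real.sqrt 2 * Real.sqrt x := by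
    rw [← Real.sqrt_mul (by norm_num : (0 : ℝ) ≤ 2)]
    exact Real.sqrt_le_sqrt (by linarith)
  have h3 : Real.sqrt 2 < 1.42 := by
    rw [Real.sqrt_lt' (by norm_num)]; norm_num
  nlinarith [Real.sqrt_nonneg x, Real.sqrt_nonneg 2]

/-- `1 ≤ log₊ x` for `x ≥ 2` (`log 4 > 1`). [folklore] -/
private theorem rtma_one_le_logPlus {x : ℝ} (hx : 2 ≤ x) : 1 ≤ logPlus x := by
  rw [logPlus_eq, abs_of_pos (by linarith : (0 : ℝ) < x)]
  have h4 : Real.log 4 = 2 * Real.log 2 := by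
    rw [show (4 : ℝ) = 2 ^ 2 by norm_num, Real.log_pow]; ring
  have h2 := Real.log_two_gt_d9
  have : Real.log 4 ≤ Real.log (2 + x) := Real.log_le_log (by norm_num) (by linarith)
  linarith

/-- The exponent bookkeeping of (35)–(36): for `x ≥ 4π`, `x ≥ 2`, `0 ≤ κ ≤ |C|`, `|t| ≤ T`,
`(x/4π)^{(9+κ log₊ x)/4} · J_t(x) = exp(E)` with `|E + πx/8| ≤ ((9+|C|)/4 + 1 + T/16 + T)·log₊² x`.
[cite: RodgersTaoFMP2020, §2 eqs. (35)–(36) (FMP p. 18)] -/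
theorem rpow_mul_rodgersTaoJ_bounds {t x κ C T : ℝ} (hx4π : 4 * π ≤ x) (hx2 : 2 ≤ x)
    (hκ0 : 0 ≤ κ) (hκC : κ ≤ |C|) (htT : |t| ≤ T) :
    Real.exp (-(π * x / 8) - ((9 + |C|) / 4 + 1 + T / 16 + T) * logPlus x ^ 2) ≤
        (x / (4 * π)) ^ ((9 + κ * logPlus x) / 4) * rodgersTaoJ t x ∧
      (x / (4 * π)) ^ ((9 + κ * logPlus x) / 4) * rodgersTaoJ t x ≤
        Real.exp (-(π * x / 8) + ((9 + |C|) / 4 + 1 + T / 16 + T) * logPlus x ^ 2) := by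
  have hπ : 0 < 4 * π := by positivity
  have hπ3 := Real.pi_gt_three
  have hπ4 := Real.pi_lt_d2
  have hx0 : 0 < x := by linarith
  have hq : 0 < x / (4 * π) := div_pos hx0 hπ
  have hq1 : 1 ≤ x / (4 * π) := by rw [le_div_iff₀ hπ]; linarith
  set L := logPlus x with hL
  set ℓ := Real.log (x / (4 * π)) with hℓ
  set m := Real.log (π / (2 * x)) with hm
  have hL1 : 1 ≤ L := rtma_one_le_logPlus hx2
  have hℓ0 : 0 ≤ ℓ := Real.log_nonneg hq1
  have hℓL : ℓ ≤ L := by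
    have h1 : ℓ ≤ Real.log x := Real.log_le_log hq (div_le_self hx0.le (by linarith))
    exact h1.trans (log_le_logPlus x)
  have hm0 : m ≤ 0 := by
    apply Real.log_nonpos (by positivity)
    rw [div_le_one (by linarith)]; linarith
  have hmL : -(2 * L) ≤ m := by
    have h1 : m = Real.log π - Real.log (2 * x) := by
      rw [hm, Real.log_div (by positivity) (by positivity)]
    have h2 : Real.log (2 * x) = Real.log 2 + Real.log x := Real.log_mul (by norm_num) hx0.ne'
    have h3 : 0 ≤ Real.log π := Real.log_nonneg (by linarith)
    have h4 : Real.log 2 < 1 := by have := Real.log_two_lt_d9; linarith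
    have h5 : Real.log x ≤ L := log_le_logPlus x
    linarith
  -- the product as a single exponential
  set E : ℝ := ℓ * ((9 + κ * L) / 4) + m / 2 +
    (t / 16 * ℓ ^ 2 - t * π ^ 2 / 64 - π * x / 8) with hE
  have hprod : (x / (4 * π)) ^ ((9 + κ * L) / 4) * rodgersTaoJ t x = Real.exp E := by
    rw [rodgersTaoJ, Real.rpow_def_of_pos hq, Real.sqrt_eq_rpow, Real.rpow_def_of_pos (by positivity),
      ← Real.exp_add, ← Real.exp_add, hE]
    congr 1; ring
  -- bound on `E + πx/8`
  have hκL : 0 ≤ κ * L := mul_nonneg hκ0 (by linarith)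
  have hκL' : κ * L ≤ |C| * L := mul_le_mul_of_nonneg_right hκC (by linarith)
  have hT0 : 0 ≤ T := (abs_nonneg t).trans htT
  have h1 : |ℓ * ((9 + κ * L) / 4)| ≤ (9 + |C|) / 4 * L ^ 2 := by
    rw [abs_of_nonneg (by positivity)]
    calc ℓ * ((9 + κ * L) / 4) ≤ L * ((9 * L + |C| * L) / 4) := by
          apply mul_le_mul hℓL _ (by positivity) (by linarith)
          gcongr; linarith
      _ = (9 + |C|) / 4 * L ^ 2 := by ring
  have h2 : |m / 2| ≤ L ^ 2 := by
    rw [abs_le]; constructor <;> nlinarith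
  have h3 : |t / 16 * ℓ ^ 2| ≤ T / 16 * L ^ 2 := by
    rw [abs_mul, abs_div, abs_of_pos (by norm_num : (0 : ℝ) < 16), abs_of_nonneg (sq_nonneg ℓ)]
    gcongr
  have h4 : |t * π ^ 2 / 64| ≤ T * L ^ 2 := by
    rw [abs_div, abs_mul, abs_of_pos (by positivity : (0 : ℝ) < π ^ 2),
      abs_of_pos (by norm_num : (0 : ℝ) < 64)]
    have : π ^ 2 ≤ 64 := by nlinarith
    calc |t| * π ^ 2 / 64 ≤ T * 64 / 64 := by gcongr
      _ = T * 1 := by ring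
      _ ≤ T * L ^ 2 := by gcongr; nlinarith
  have hEup : E + π * x / 8 ≤ ((9 + |C|) / 4 + 1 + T / 16 + T) * L ^ 2 := by
    have e : E + π * x / 8 = ℓ * ((9 + κ * L) / 4) + m / 2 + t / 16 * ℓ ^ 2 - t * π ^ 2 / 64 := by
      rw [hE]; ring
    rw [e]
    have := le_abs_self (ℓ * ((9 + κ * L) / 4)); have := le_abs_self (m / 2)
    have := le_abs_self (t / 16 * ℓ ^ 2); have := neg_abs_le (t * π ^ 2 / 64)
    linarith
  have hElow : -(((9 + |C|) / 4 + 1 + T / 16 + T) * L ^ 2) ≤ E + π * x / 8 := by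
    have e : E + π * x / 8 = ℓ * ((9 + κ * L) / 4) + m / 2 + t / 16 * ℓ ^ 2 - t * π ^ 2 / 64 := by
      rw [hE]; ring
    rw [e]
    have := neg_abs_le (ℓ * ((9 + κ * L) / 4)); have := neg_abs_le (m / 2)
    have := neg_abs_le (t / 16 * ℓ ^ 2); have := le_abs_self (t * π ^ 2 / 64)
    linarith
  rw [hprod]
  constructor
  · exact Real.exp_le_exp.2 (by linarith)
  · exact Real.exp_le_exp.2 (by linarith)

/-- **Lemma 2.1 (8) for `−T₀ ≤ t ≤ 0` as a reduction** (Rodgers–Tao 2020, FMP Lemma 4 p. 8, proof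
pp. 11–19): the p. 19 display `H_t = (½ + O_C(log₊² x/x)) Q_{t,1}` and (36)
`|Q_{t,1}| = (2π² + O_C(x^{-1/2}))(x/4π)^{(9+y)/4} J_t` give, for `t < 0`,
`|H_t(x − iκ log₊ x)| ≍ (x/4π)^{(9+κ log₊ x)/4} J_t(x) = exp(−πx/8 + O_{C,T₀}(log₊² x))`; at `t = 0`
the bound is the proved display after (13) (`rodgersTao_H0_twoSided_holds`, `y = κ log₊ x ≥ 4`).
[cite: RodgersTaoFMP2020, Lemma 2.1 eq. (8) (FMP Lemma 4 p. 8; proof pp. 11–19)] -/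
theorem rodgersTao_H_asymp_of (hQ : rodgersTao_H_eq_half_Q_one) (h36 : rodgersTao_Q_one_asymp) :
    rodgersTao_H_asymp := by
  intro T₀
  obtain ⟨C'₁, hC'₁, h1⟩ := hQ T₀
  obtain ⟨C'₂, hC'₂, h2⟩ := h36 T₀
  obtain ⟨A₀, hA₀, h0⟩ := rodgersTao_H0_twoSided_holds
  refine ⟨max (max C'₁ C'₂) 6, lt_max_of_lt_right (by norm_num), fun C ↦ ?_⟩
  obtain ⟨C''₁, A₁, hC''₁, hA₁, h1C⟩ := h1 C
  obtain ⟨C''₂, A₂, hC''₂, hA₂, h2C⟩ := h2 C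
  have hπ : 0 < 4 * π := by positivity
  have hπ3 := Real.pi_gt_three
  have hπlo := Real.pi_gt_d2
  have hπhi := Real.pi_lt_d2
  set A₃ : ℝ := (9 + |C|) / 4 + 1 + |T₀| / 16 + |T₀| with hA₃
  have hA₃0 : 0 ≤ A₃ := by positivity
  set A : ℝ := A₃ + 3 + A₀ * (1 + |C|) ^ 2 + 1 with hA
  have hApos : 0 < A := by positivity
  set X₁ : ℝ := (92 * A₁) ^ 2 + A₂ ^ 2 + 4 * π + 2 with hX₁
  refine ⟨C''₁ + C''₂ + X₁, A, by positivity, hApos, fun t ht x hx κ hκ ↦ ?_⟩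
  -- ranges
  have hκ6 : 6 ≤ κ := le_trans (le_max_right _ _) hκ.1
  have hκ1 : C'₁ ≤ κ := le_trans ((le_max_left _ _).trans (le_max_left _ _)) hκ.1
  have hκ2 : C'₂ ≤ κ := le_trans ((le_max_right _ _).trans (le_max_left _ _)) hκ.1
  have hκ0 : 0 ≤ κ := by linarith
  have hκC : κ ≤ |C| := hκ.2.trans (le_abs_self C)
  have hX₁x : X₁ ≤ x := by linarith
  have hx1 : C''₁ ≤ x := by nlinarith [sq_nonneg (92 * A₁), sq_nonneg A₂]
  have hx2 : C''₂ ≤ x := by nlinarith [sq_nonneg (92 * A₁), sq_nonneg A₂]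
  have hx2' : 2 ≤ x := by rw [hX₁] at hX₁x; nlinarith [sq_nonneg (92 * A₁), sq_nonneg A₂]
  have hx4π : 4 * π ≤ x := by rw [hX₁] at hX₁x; nlinarith [sq_nonneg (92 * A₁), sq_nonneg A₂]
  have hxA₁ : (92 * A₁) ^ 2 ≤ x := by rw [hX₁] at hX₁x; nlinarith [sq_nonneg A₂]
  have hxA₂ : A₂ ^ 2 ≤ x := by rw [hX₁] at hX₁x; nlinarith [sq_nonneg (92 * A₁)]
  have hx0 : 0 < x := by linarith
  set L := logPlus x with hL
  have hL1 : 1 ≤ L := rtma_one_le_logPlus hx2'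
  have hL0 : 0 < L := by linarith
  have htT : |t| ≤ |T₀| := by
    rw [abs_of_nonpos ht.2]; have := ht.1; have := le_abs_self T₀; linarith
  have hA₃A : A₃ + 3 ≤ A := by rw [hA]; nlinarith [sq_nonneg (1 + |C|)]
  rcases eq_or_lt_of_le ht.2 with ht0 | htneg
  · -- the endpoint `t = 0`: display after (13)
    subst ht0
    have hy4 : 4 ≤ κ * L := by
      have h6L : 6 * 1 ≤ κ * L := mul_le_mul hκ6 hL1 zero_le_one hκ0
      linarith only [h6L]
    -- the exponent `A₀ (1 + y) log₊(x + y) ≤ A₀ (1+|C|)² log₊² x ≤ A log₊² x`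
    have hyC : κ * L ≤ |C| * L := mul_le_mul_of_nonneg_right hκC hL0.le
    have h1y : 1 + κ * L ≤ (1 + |C|) * L := by
      have e : (1 + |C|) * L = L + |C| * L := by ring
      rw [e]; linarith only [hL1, hyC]
    have hκL0 : 0 ≤ κ * L := mul_nonneg hκ0 hL0.le
    have hxy0 : 0 < x + κ * L := by linarith
    have hLxy : logPlus (x + κ * L) ≤ (1 + |C|) * L := by
      rw [logPlus_eq, abs_of_pos hxy0]
      have hLle : L ≤ 2 + x := by
        rw [hL, logPlus_eq, abs_of_pos hx0]
        have := Real.log_le_sub_one_of_pos (show 0 < 2 + x by linarith); linarith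
      have hle : 2 + (x + κ * L) ≤ (2 + x) * (1 + κ) := by
        have h' : κ * L ≤ κ * (2 + x) := mul_le_mul_of_nonneg_left hLle hκ0
        have e : (2 + x) * (1 + κ) = 2 + x + κ * (2 + x) := by ring
        rw [e]; linarith only [h']
      have h2x : 0 < 2 + x := by linarith
      have h1κ : 0 < 1 + κ := by linarith
      have h1 : Real.log (2 + (x + κ * L)) ≤ Real.log ((2 + x) * (1 + κ)) :=
        Real.log_le_log (by linarith) hle
      rw [Real.log_mul h2x.ne' h1κ.ne'] at h1
      have h2 : Real.log (1 + κ) ≤ κ := by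
        have := Real.log_le_sub_one_of_pos h1κ; linarith
      have h3 : Real.log (2 + x) = L := by rw [hL, logPlus_eq, abs_of_pos hx0]
      have h4 : κ ≤ |C| * L := by
        calc κ = κ * 1 := (mul_one κ).symm
          _ ≤ |C| * L := mul_le_mul hκC hL1 zero_le_one (abs_nonneg C)
      linarith only [h1, h2, h3, h4]
    have hexp : A₀ * (1 + κ * L) * logPlus (x + κ * L) ≤ A * L ^ 2 := by
      have hA0A : A₀ * (1 + |C|) ^ 2 ≤ A := by rw [hA]; linarith
      have hCL : 0 ≤ (1 + |C|) * L := by positivity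
      calc A₀ * (1 + κ * L) * logPlus (x + κ * L)
          ≤ A₀ * ((1 + |C|) * L) * ((1 + |C|) * L) := by
            apply mul_le_mul (mul_le_mul_of_nonneg_left h1y hA₀.le) hLxy (logPlus_nonneg _)
            exact mul_nonneg hA₀.le hCL
        _ = A₀ * (1 + |C|) ^ 2 * L ^ 2 := by ring
        _ ≤ A * L ^ 2 := mul_le_mul_of_nonneg_right hA0A (sq_nonneg _)
    have hxabs : |x| = x := abs_of_pos hx0
    have he1 : -(π * x / 8) - A * L ^ 2 ≤
        -(π * |x| / 8) - A₀ * (1 + κ * L) * logPlus (|x| + κ * L) := by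
      rw [hxabs]; linarith only [hexp]
    have he2 : -(π * |x| / 8) + A₀ * (1 + κ * L) * logPlus (|x| + κ * L) ≤
        -(π * x / 8) + A * L ^ 2 := by
      rw [hxabs]; linarith only [hexp]
    obtain ⟨hlow, hup⟩ := h0 x (κ * L) hy4
    exact ⟨(Real.exp_le_exp.2 he1).trans hlow, hup.trans (Real.exp_le_exp.2 he2)⟩
  · -- `t < 0`: combine the p. 19 display with (36)
    have ht' : t ∈ Ico (-T₀) 0 := ⟨ht.1, htneg⟩
    have hE := h1C t ht' x hx1 κ ⟨hκ1, hκ.2⟩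
    have hR := h2C t ht' x hx2 κ ⟨hκ2, hκ.2⟩
    obtain ⟨hPJlow, hPJup⟩ := rpow_mul_rodgersTaoJ_bounds (C := C) (T := |T₀|) hx4π hx2' hκ0 hκC htT
    -- names
    generalize hHdef : deBruijnH t (rodgersTaoZ x κ) = H at hE ⊢
    generalize hQdef : rodgersTaoQ t 1 x (κ * logPlus x) = Qc at hE hR
    generalize hPJdef : (x / (4 * π)) ^ ((9 + κ * logPlus x) / 4) * rodgersTaoJ t x = PJ
      at hR hPJlow hPJup
    clear hHdef hQdef hPJdef h1C h2C h0
    have hPJ0 : 0 < PJ := lt_of_lt_of_le (Real.exp_pos _) hPJlow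
    set Q := ‖Qc‖ with hQ
    have hQ0 : 0 ≤ Q := norm_nonneg _
    -- (36): `18 PJ ≤ Q ≤ 21 PJ`
    have hsx : A₂ ≤ Real.sqrt x := by
      calc A₂ ≤ |A₂| := le_abs_self _
        _ = Real.sqrt (A₂ ^ 2) := (Real.sqrt_sq_eq_abs A₂).symm
        _ ≤ Real.sqrt x := Real.sqrt_le_sqrt hxA₂
    have hsx0 : 0 < Real.sqrt x := Real.sqrt_pos.2 hx0
    have hR1 : |Q / PJ - 2 * π ^ 2| ≤ 1 := by
      refine hR.trans ?_
      rw [div_le_one hsx0]; exact hsx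
    obtain ⟨hRa, hRb⟩ := abs_sub_le_iff.1 hR1
    have hπsqhi : π ^ 2 < 3.15 * 3.15 := by
      rw [pow_two]; exact mul_lt_mul'' hπhi hπhi (by positivity) (by positivity)
    have hπsqlo : 3.14 * 3.14 < π ^ 2 := by
      rw [pow_two]; exact mul_lt_mul'' hπlo hπlo (by norm_num) (by norm_num)
    have hQup : Q ≤ 21 * PJ := by
      have : Q / PJ ≤ 21 := by linarith only [hRa, hπsqhi]
      rwa [div_le_iff₀ hPJ0] at this
    have hQlow : 18 * PJ ≤ Q := by
      have : 18 ≤ Q / PJ := by linarith only [hRb, hπsqlo]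
      rwa [le_div_iff₀ hPJ0] at this
    -- p. 19: `Q/4 ≤ ‖H‖ ≤ Q`
    have hsmall : A₁ * (L ^ 2 / x) ≤ 1 / 4 := by
      have hg := rtma_logPlus_sq_le_sqrt hx2'
      have hs1 : 92 * A₁ ≤ Real.sqrt x := by
        calc 92 * A₁ = Real.sqrt ((92 * A₁) ^ 2) := (Real.sqrt_sq (by positivity)).symm
          _ ≤ Real.sqrt x := Real.sqrt_le_sqrt hxA₁
      have hss : Real.sqrt x * Real.sqrt x = x := Real.mul_self_sqrt hx0.le
      rw [← mul_div_assoc, div_le_iff₀ hx0]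
      calc A₁ * L ^ 2 ≤ A₁ * (23 * Real.sqrt x) := mul_le_mul_of_nonneg_left hg hA₁.le
        _ = (92 * A₁) * Real.sqrt x / 4 := by ring
        _ ≤ Real.sqrt x * Real.sqrt x / 4 := by gcongr
        _ = 1 / 4 * x := by rw [hss]; ring
    have hErr : ‖H - Qc / 2‖ ≤ Q / 4 := by
      calc ‖H - Qc / 2‖ ≤ A₁ * (L ^ 2 / x) * Q := hE
        _ ≤ 1 / 4 * Q := mul_le_mul_of_nonneg_right hsmall hQ0
        _ = Q / 4 := by ring
    have hQc2 : ‖Qc / 2‖ = Q / 2 := by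
      rw [norm_div]; norm_num [hQ]
    have hHup : ‖H‖ ≤ 16 * PJ := by
      have h' : ‖H‖ ≤ ‖Qc / 2‖ + ‖H - Qc / 2‖ := by
        have := norm_add_le (Qc / 2) (H - Qc / 2)
        rwa [add_sub_cancel] at this
      linarith only [h', hQc2, hErr, hQup, hPJ0]
    have hHlow : PJ ≤ ‖H‖ := by
      have h' : ‖Qc / 2‖ - ‖H‖ ≤ ‖Qc / 2 - H‖ := norm_sub_norm_le _ _
      rw [norm_sub_rev] at h'
      linarith only [h', hQc2, hErr, hQlow, hPJ0]
    -- assemble with the exponent bookkeeping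
    have h16 : (16 : ℝ) ≤ Real.exp 3 := by
      have he := Real.exp_one_gt_d9
      have h27 : (2.7 : ℝ) ≤ Real.exp 1 := by linarith only [he]
      have e3 : Real.exp 3 = Real.exp 1 ^ 3 := by
        rw [← Real.exp_nat_mul]; norm_num
      rw [e3]
      calc (16 : ℝ) ≤ 2.7 ^ 3 := by norm_num
        _ ≤ Real.exp 1 ^ 3 := pow_le_pow_left₀ (by norm_num) h27 3
    have h3L : 3 ≤ 3 * L ^ 2 := by
      have : 1 ≤ L ^ 2 := one_le_pow₀ hL1
      linarith only [this]
    have hA₃le : (9 + |C|) / 4 + 1 + |T₀| / 16 + |T₀| ≤ A := by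
      have : (9 + |C|) / 4 + 1 + |T₀| / 16 + |T₀| = A₃ := by rw [hA₃]
      linarith only [this, hA₃A]
    have hL2 : 0 ≤ L ^ 2 := sq_nonneg _
    constructor
    · calc Real.exp (-(π * x / 8) - A * L ^ 2)
          ≤ Real.exp (-(π * x / 8) - ((9 + |C|) / 4 + 1 + |T₀| / 16 + |T₀|) * L ^ 2) := by
            apply Real.exp_le_exp.2
            have h' : ((9 + |C|) / 4 + 1 + |T₀| / 16 + |T₀|) * L ^ 2 ≤ A * L ^ 2 :=
              mul_le_mul_of_nonneg_right hA₃le hL2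
            linarith only [h']
        _ ≤ PJ := hPJlow
        _ ≤ ‖H‖ := hHlow
    · calc ‖H‖ ≤ 16 * PJ := hHup
        _ ≤ Real.exp 3 *
            Real.exp (-(π * x / 8) + ((9 + |C|) / 4 + 1 + |T₀| / 16 + |T₀|) * L ^ 2) :=
            mul_le_mul h16 hPJup hPJ0.le (Real.exp_pos _).le
        _ = Real.exp (3 + (-(π * x / 8) + ((9 + |C|) / 4 + 1 + |T₀| / 16 + |T₀|) * L ^ 2)) := by
            rw [← Real.exp_add]
        _ ≤ Real.exp (-(π * x / 8) + A * L ^ 2) := by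
            apply Real.exp_le_exp.2
            have h' : ((9 + |C|) / 4 + 1 + |T₀| / 16 + |T₀| + 3) * L ^ 2 ≤ A * L ^ 2 :=
              mul_le_mul_of_nonneg_right (by linarith only [hA₃le, hA₃A, hA₃]) hL2
            linarith only [h', h3L]

end Literature.NumberTheory.LFunctions

end
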